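import Literature.Analysis.FluidPDE.QuasiStaticSlotWeight
import HarnessLib

/-!
# The quasi-statically realised slot weight `ϑ(ρ, T)` of a ramped Kolmogorov layer — CLOSED FORM

`Literature.Analysis.FluidPDE.QuasiStaticSlotWeight` proves the exact piecewise identity
`λ∫₀^τ aJ = τ(1 − 4ρ/3) − (J(ρτ) + J(τ−ρτ) − J(τ))/(ρτλ)` (`mul_integral_trapezoid_duhamel_eq`) for the trapezoid
envelope `a` with linear ramps of relative length `ρ ≤ 1/2` and the Duhamel response `J(s) = e^{−λs}∫₀ˢe^{λx}a(x)dx`,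
and the two-sided lag law `|ϑ(ρ,T) − (1 − 4ρ/3)| ≤ 2/(ρT²)`.  The eigen-centred even certificate of the `ad-ideate` cell's
K1L_D line needs `ϑ` to relative precision `10⁻⁴` (the only radial slack of the quasi-static design map is the
subhomogeneity `(ϑ(T) − ϑ(T/λ))/ϑ(T) ≈ 12(λ²−1)/T²`, `≈ 10⁻³` at `λ = 1.05`, `T = 30`), which the lag law cannot give.
This file evaluates the three corner values of `J` for the unit slot (`τ = 1`) and proves the **closed form**
`ϑ(ρ, T) = T∫₀¹ a(s) e^{−Ts}∫₀ˢ e^{Tx}a(x) dx ds = (1 − 4ρ/3) − 2/(ρT²) + (2 − E)/(ρ²T³)`,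
`E = 2e^{−Tρ} − e^{−T(1−2ρ)} + 2e^{−T(1−ρ)} − e^{−T}` (`0 < ρ ≤ 1/2`, `T > 0`; for the triangle `ρ = 1/2` the plateau term
`e^{−T(1−2ρ)}` is `1`): `integral_exp_mul_trapezoid_ramp_up / _plateau / _ramp_down` (the three pieces by the fundamental
theorem of calculus), `duhamel_trapezoid_at_ramp / _at_shoulder / _at_end` (the corner values), `slotWeight_closed_form`.
Elementary calculus; the numerical check `ϑ(1/2, 30) = 0.3293333…`, `ϑ(1/4, 20) = 0.65064…` agrees with quadrature.
No definitions, no named facts, no sorry.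
-/

noncomputable section

namespace Literature.Analysis.FluidPDE.LatticeShear

open MeasureTheory intervalIntegral Set Real

section ClosedForm

/-- The unit trapezoid envelope is continuous. [folklore] -/
private theorem continuous_trapezoid_one (ρ : ℝ) : Continuous fun s => LatticeWord.trapezoid 0 1 ρ s := by
  unfold LatticeWord.trapezoid; fun_prop

/-- The Duhamel integrand `x ↦ e^{Tx} a(x)` of the unit slot is interval integrable. [folklore] -/
private theorem intervalIntegrable_exp_mul_trapezoid (T ρ a b : ℝ) :
    IntervalIntegrable (fun x => Real.exp (T * x) * LatticeWord.trapezoid 0 1 ρ x) volume a b :=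
  ((by fun_prop : Continuous fun x => Real.exp (T * x)).mul (continuous_trapezoid_one ρ)).intervalIntegrable _ _

/-- **Up-ramp piece**: `∫₀^ρ e^{Tx} a(x) dx = ((ρ/T − 1/T²)e^{Tρ} + 1/T²)/ρ` (`a(x) = x/ρ` there). [cite: MajdaKramer1999, §2.2.1.3 (55)] -/
theorem integral_exp_mul_trapezoid_ramp_up {ρ T : ℝ} (hρ : 0 < ρ) (hρ2 : ρ ≤ 1 / 2) (hT : 0 < T) :
    ∫ x in (0:ℝ)..ρ, Real.exp (T * x) * LatticeWord.trapezoid 0 1 ρ x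
      = ((ρ / T - 1 / T ^ 2) * Real.exp (T * ρ) + 1 / T ^ 2) / ρ := by
  have hT0 : T ≠ 0 := hT.ne'
  have hcongr : ∫ x in (0:ℝ)..ρ, Real.exp (T * x) * LatticeWord.trapezoid 0 1 ρ x
      = ∫ x in (0:ℝ)..ρ, Real.exp (T * x) * x / ρ := by
    refine intervalIntegral.integral_congr fun x hx => ?_
    rw [uIcc_of_le hρ.le] at hx
    have h := trapezoid_eq_of_mem_ramp_up one_pos hρ hρ2 (s := x) (by simpa using hx)
    simp only [h, mul_one]
    ring
  rw [hcongr]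
  have hF : ∀ x ∈ uIcc (0:ℝ) ρ, HasDerivAt (fun y => (y / T - 1 / T ^ 2) * Real.exp (T * y) / ρ)
      (Real.exp (T * x) * x / ρ) x := by
    intro x _
    have h1 : HasDerivAt (fun y => y / T - 1 / T ^ 2) (1 / T) x := by
      simpa using ((hasDerivAt_id x).div_const T).sub_const (1 / T ^ 2)
    have h2 : HasDerivAt (fun y => Real.exp (T * y)) (Real.exp (T * x) * T) x := by
      simpa using ((hasDerivAt_id x).const_mul T).exp
    have h := (h1.mul h2).div_const ρ
    refine h.congr_deriv ?_
    field_simp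
    ring
  rw [intervalIntegral.integral_eq_sub_of_hasDerivAt hF
    ((by fun_prop : Continuous fun x => Real.exp (T * x) * x / ρ).intervalIntegrable _ _)]
  simp only [mul_zero, Real.exp_zero, zero_div]
  ring

/-- **Plateau piece**: `∫_ρ^{1−ρ} e^{Tx} a(x) dx = (e^{T(1−ρ)} − e^{Tρ})/T` (`a = 1` there). [cite: MajdaKramer1999, §2.2.1.3 (55)] -/
theorem integral_exp_mul_trapezoid_plateau {ρ T : ℝ} (hρ : 0 < ρ) (hρ2 : ρ ≤ 1 / 2) (hT : 0 < T) :
    ∫ x in ρ..(1 - ρ), Real.exp (T * x) * LatticeWord.trapezoid 0 1 ρ x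
      = (Real.exp (T * (1 - ρ)) - Real.exp (T * ρ)) / T := by
  have hle : ρ ≤ 1 - ρ := by linarith
  have hcongr : ∫ x in ρ..(1 - ρ), Real.exp (T * x) * LatticeWord.trapezoid 0 1 ρ x
      = ∫ x in ρ..(1 - ρ), Real.exp (T * x) := by
    refine intervalIntegral.integral_congr fun x hx => ?_
    rw [uIcc_of_le hle] at hx
    have h := trapezoid_eq_of_mem_plateau one_pos hρ (τ := 1) (s := x) (by simpa using hx)
    simp only [h, mul_one]
  rw [hcongr]
  have hF : ∀ x ∈ uIcc ρ (1 - ρ), HasDerivAt (fun y => Real.exp (T * y) / T) (Real.exp (T * x)) x := by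
    intro x _
    have h := (((hasDerivAt_id x).const_mul T).exp).div_const T
    simp only [id, mul_one] at h
    exact h.congr_deriv (by field_simp)
  rw [intervalIntegral.integral_eq_sub_of_hasDerivAt hF
    ((by fun_prop : Continuous fun x => Real.exp (T * x)).intervalIntegrable _ _)]
  ring

/-- **Down-ramp piece**: `∫_{1−ρ}^1 e^{Tx} a(x) dx = (e^{T}/T² − (ρ/T + 1/T²)e^{T(1−ρ)})/ρ` (`a(x) = (1−x)/ρ` there).
[cite: MajdaKramer1999, §2.2.1.3 (55)] -/
theorem integral_exp_mul_trapezoid_ramp_down {ρ T : ℝ} (hρ : 0 < ρ) (hρ2 : ρ ≤ 1 / 2) (hT : 0 < T) :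
    ∫ x in (1 - ρ)..1, Real.exp (T * x) * LatticeWord.trapezoid 0 1 ρ x
      = (Real.exp T / T ^ 2 - (ρ / T + 1 / T ^ 2) * Real.exp (T * (1 - ρ))) / ρ := by
  have hT0 : T ≠ 0 := hT.ne'
  have hle : 1 - ρ ≤ 1 := by linarith
  have hcongr : ∫ x in (1 - ρ)..1, Real.exp (T * x) * LatticeWord.trapezoid 0 1 ρ x
      = ∫ x in (1 - ρ)..1, Real.exp (T * x) * (1 - x) / ρ := by
    refine intervalIntegral.integral_congr fun x hx => ?_
    rw [uIcc_of_le hle] at hx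
    have h := trapezoid_eq_of_mem_ramp_down one_pos hρ hρ2 (τ := 1) (s := x) (by simpa using hx)
    simp only [h, mul_one]
    ring
  rw [hcongr]
  have hF : ∀ x ∈ uIcc (1 - ρ) (1:ℝ), HasDerivAt (fun y => ((1 - y) / T + 1 / T ^ 2) * Real.exp (T * y) / ρ)
      (Real.exp (T * x) * (1 - x) / ρ) x := by
    intro x _
    have h1 : HasDerivAt (fun y => (1 - y) / T + 1 / T ^ 2) (-1 / T) x := by
      have := (((hasDerivAt_id x).const_sub 1).div_const T).add_const (1 / T ^ 2)
      simpa using this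
    have h2 : HasDerivAt (fun y => Real.exp (T * y)) (Real.exp (T * x) * T) x := by
      simpa using ((hasDerivAt_id x).const_mul T).exp
    have h := (h1.mul h2).div_const ρ
    refine h.congr_deriv ?_
    field_simp
    ring
  rw [intervalIntegral.integral_eq_sub_of_hasDerivAt hF
    ((by fun_prop : Continuous fun x => Real.exp (T * x) * (1 - x) / ρ).intervalIntegrable _ _)]
  simp only [mul_one, sub_self, zero_div, zero_add]
  ring

/-- Corner value of the Duhamel response at the top of the up-ramp: `J(ρ) = 1/T − 1/(ρT²) + e^{−Tρ}/(ρT²)`.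
[cite: MajdaKramer1999, §2.2.1.3 (55)] -/
theorem duhamel_trapezoid_at_ramp {ρ T : ℝ} (hρ : 0 < ρ) (hρ2 : ρ ≤ 1 / 2) (hT : 0 < T) :
    Real.exp (-T * ρ) * ∫ x in (0:ℝ)..ρ, Real.exp (T * x) * LatticeWord.trapezoid 0 1 ρ x
      = 1 / T - 1 / (ρ * T ^ 2) + Real.exp (-(T * ρ)) / (ρ * T ^ 2) := by
  rw [integral_exp_mul_trapezoid_ramp_up hρ hρ2 hT]
  have hT0 : T ≠ 0 := hT.ne'
  have hρ0 : ρ ≠ 0 := hρ.ne'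
  set P := Real.exp (T * ρ) with hP
  have hP0 : P ≠ 0 := (Real.exp_pos _).ne'
  have e1 : Real.exp (-T * ρ) = P⁻¹ := by
    rw [hP, ← Real.exp_neg]; congr 1; ring
  have e2 : Real.exp (-(T * ρ)) = P⁻¹ := by rw [hP, ← Real.exp_neg]
  rw [e1, e2]
  field_simp

/-- Corner value at the shoulder of the down-ramp: `J(1−ρ) = 1/T − e^{−T(1−2ρ)}/(ρT²) + e^{−T(1−ρ)}/(ρT²)`.
[cite: MajdaKramer1999, §2.2.1.3 (55)] -/
theorem duhamel_trapezoid_at_shoulder {ρ T : ℝ} (hρ : 0 < ρ) (hρ2 : ρ ≤ 1 / 2) (hT : 0 < T) :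
    Real.exp (-T * (1 - ρ)) * ∫ x in (0:ℝ)..(1 - ρ), Real.exp (T * x) * LatticeWord.trapezoid 0 1 ρ x
      = 1 / T - Real.exp (-(T * (1 - 2 * ρ))) / (ρ * T ^ 2) + Real.exp (-(T * (1 - ρ))) / (ρ * T ^ 2) := by
  rw [← intervalIntegral.integral_add_adjacent_intervals (intervalIntegrable_exp_mul_trapezoid T ρ 0 ρ)
    (intervalIntegrable_exp_mul_trapezoid T ρ ρ (1 - ρ)),
    integral_exp_mul_trapezoid_ramp_up hρ hρ2 hT, integral_exp_mul_trapezoid_plateau hρ hρ2 hT]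
  have hT0 : T ≠ 0 := hT.ne'
  have hρ0 : ρ ≠ 0 := hρ.ne'
  set P := Real.exp (T * ρ) with hP
  set Q := Real.exp (T * (1 - ρ)) with hQ
  have hP0 : P ≠ 0 := (Real.exp_pos _).ne'
  have hQ0 : Q ≠ 0 := (Real.exp_pos _).ne'
  have e1 : Real.exp (-T * (1 - ρ)) = Q⁻¹ := by
    rw [hQ, ← Real.exp_neg]; congr 1; ring
  have e2 : Real.exp (-(T * (1 - ρ))) = Q⁻¹ := by rw [hQ, ← Real.exp_neg]
  have e3 : Real.exp (-(T * (1 - 2 * ρ))) = P * Q⁻¹ := by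
    rw [hP, hQ, ← Real.exp_neg, ← Real.exp_add]; congr 1; ring
  rw [e1, e2, e3]
  field_simp
  ring

/-- Corner value at the end of the slot: `J(1) = (1 − e^{−Tρ} − e^{−T(1−ρ)} + e^{−T})/(ρT²)`. [cite: MajdaKramer1999, §2.2.1.3 (55)] -/
theorem duhamel_trapezoid_at_end {ρ T : ℝ} (hρ : 0 < ρ) (hρ2 : ρ ≤ 1 / 2) (hT : 0 < T) :
    Real.exp (-T * 1) * ∫ x in (0:ℝ)..1, Real.exp (T * x) * LatticeWord.trapezoid 0 1 ρ x
      = (1 - Real.exp (-(T * ρ)) - Real.exp (-(T * (1 - ρ))) + Real.exp (-T)) / (ρ * T ^ 2) := by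
  rw [← intervalIntegral.integral_add_adjacent_intervals (intervalIntegrable_exp_mul_trapezoid T ρ 0 (1 - ρ))
    (intervalIntegrable_exp_mul_trapezoid T ρ (1 - ρ) 1),
    ← intervalIntegral.integral_add_adjacent_intervals (intervalIntegrable_exp_mul_trapezoid T ρ 0 ρ)
    (intervalIntegrable_exp_mul_trapezoid T ρ ρ (1 - ρ)),
    integral_exp_mul_trapezoid_ramp_up hρ hρ2 hT, integral_exp_mul_trapezoid_plateau hρ hρ2 hT,
    integral_exp_mul_trapezoid_ramp_down hρ hρ2 hT]
  have hT0 : T ≠ 0 := hT.ne'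
  have hρ0 : ρ ≠ 0 := hρ.ne'
  set P := Real.exp (T * ρ) with hP
  set Q := Real.exp (T * (1 - ρ)) with hQ
  have hP0 : P ≠ 0 := (Real.exp_pos _).ne'
  have hQ0 : Q ≠ 0 := (Real.exp_pos _).ne'
  have e1 : Real.exp (-T * 1) = P⁻¹ * Q⁻¹ := by
    rw [hP, hQ, ← Real.exp_neg, ← Real.exp_neg, ← Real.exp_add]; congr 1; ring
  have e2 : Real.exp (-(T * ρ)) = P⁻¹ := by rw [hP, ← Real.exp_neg]
  have e3 : Real.exp (-(T * (1 - ρ))) = Q⁻¹ := by rw [hQ, ← Real.exp_neg]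
  have e4 : Real.exp (-T) = P⁻¹ * Q⁻¹ := by
    rw [hP, hQ, ← Real.exp_neg, ← Real.exp_neg, ← Real.exp_add]; congr 1; ring
  have e5 : Real.exp T = P * Q := by
    rw [hP, hQ, ← Real.exp_add]; congr 1; ring
  rw [e1, e2, e3, e4, e5]
  field_simp
  ring

/-- **CLOSED FORM of the realised slot weight** (`0 < ρ ≤ 1/2`, `T > 0`):
`ϑ(ρ, T) = T∫₀¹ a(s) e^{−Ts}∫₀ˢ e^{Tx}a(x) dx ds = (1 − 4ρ/3) − 2/(ρT²) + (2 − E)/(ρ²T³)`,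
`E = 2e^{−Tρ} − e^{−T(1−2ρ)} + 2e^{−T(1−ρ)} − e^{−T}` (triangle `ρ = 1/2`: `E = 4e^{−T/2} − 1 − e^{−T}`).
[cite: MajdaKramer1999, §2.2.1.3 (55) (quasi-static depletion of a time-modulated shear)] -/
theorem slotWeight_closed_form {ρ T : ℝ} (hρ : 0 < ρ) (hρ2 : ρ ≤ 1 / 2) (hT : 0 < T) :
    T * ∫ s in (0:ℝ)..1, LatticeWord.trapezoid 0 1 ρ s *
        (Real.exp (-T * s) * ∫ x in (0:ℝ)..s, Real.exp (T * x) * LatticeWord.trapezoid 0 1 ρ x)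
      = (1 - 4 * ρ / 3) - 2 / (ρ * T ^ 2)
        + (2 - (2 * Real.exp (-(T * ρ)) - Real.exp (-(T * (1 - 2 * ρ))) + 2 * Real.exp (-(T * (1 - ρ))) - Real.exp (-T)))
          / (ρ ^ 2 * T ^ 3) := by
  have h := mul_integral_trapezoid_duhamel_eq (τ := 1) one_pos hρ hρ2 hT
  simp only [mul_one, one_mul] at h
  rw [h, duhamel_trapezoid_at_ramp hρ hρ2 hT, duhamel_trapezoid_at_shoulder hρ hρ2 hT]
  have hend := duhamel_trapezoid_at_end hρ hρ2 hT
  rw [mul_one] at hend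
  rw [hend]
  have hT0 : T ≠ 0 := hT.ne'
  have hρ0 : ρ ≠ 0 := hρ.ne'
  field_simp
  ring

end ClosedForm

end Literature.Analysis.FluidPDE.LatticeShear
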